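import Summits.ValiantsHypothesis.ValiantsHypothesis.Theorems.BarrierLeverDefinableEquationsUnipotentAction

/-!
# Cruxes `BarrierLever.DefinableEquations` (8745) / `SingleSizeEquations` (8749) — ELEMENTARY
# UNIPOTENTS: the coefficient formula and the factorisation `u_s = Π_{i<j} e_ij(s_ij)`

Third file of the "U-half" of the normal-form programme (design memo `HWV-NORMAL-FORM-PLAN.md`,
evidence #9 on stmt-ValiantsHypothesis-8749).  Two elementary facts that make the coefficient
action `c ↦ coeff(f_c ∘ u_s)` of `…UnipotentAction.lean` a `poly(N)`-size circuit JOINTLY in the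
coefficient vector `c` and the group parameters `s` (`…UnipotentCoefficients.lean`):

* `coeff_aeval_elemU` — for ONE elementary unipotent `e_ij(σ) : x_j ↦ x_j + σ x_i` (`i ≠ j`) the
  action on coefficients is explicit and sparse:
  `coeff_m (g ∘ e_ij(σ)) = Σ_{k ≤ m_i} C(m_j + k, k) σ^k · coeff_{m - kε_i + kε_j} g`
  (`≤ n + 1` terms, binomial theorem on `(x_j + σ x_i)^{m'_j}`);
* `aeval_unip_eq_compU` — the full substitution `u_s : x_j ↦ x_j + Σ_{i<j} s_ij x_i` is the
  composite of the `n(n-1)/2` elementary substitutions `e_ij(s_ij)` WITH THE SAME PARAMETERS, taken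
  along the positive roots `(i, j)` row by row in decreasing `i` (`pairList`, outermost first):
  in this order no cross terms appear (`compU_eq_aeval`).

Elementary; small definitions (`elemU`, `rowList`, `pairList`, `compU`, `unipL` abbreviate explicit
expressions), no named facts.  HONEST FRAMING: infrastructure for a normal form; nothing here bears
on the open content of the cruxes.  References: [Burgisser2000] Rem. 2.7 (substitution);
[MignonRessayre2004] §1 (frame).
-/

-- layout Summits/ValiantsHypothesis/ValiantsHypothesis forces the duplicated namespace component
set_option linter.dupNamespace false

noncomputable section

open MvPolynomial

namespace Summit.ValiantsHypothesis.ValiantsHypothesis.Theorems.BarrierLever.IsobaricEquations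

open Literature.Computability.AlgebraicComplexity Literature.Barriers.ValiantsHypothesis

variable {n : ℕ}

/-! ## §3 Elementary unipotent substitutions: the coefficient formula -/

section elementary

/-- The elementary unipotent substitution `e_ij(σ) : x_j ↦ x_j + σ x_i` (other variables fixed; the
literal expression of `…UnipotentTranslates.lean`). [cite: Burgisser2000, Rem. 2.7] -/
def elemU (i j : Fin n) (σ : ℂ) (k : Fin n) : MvPolynomial (Fin n) ℂ :=
  if k = j then X j + C σ * X i else X k

/-- Unfolding `elemU`. [folklore] -/
theorem elemU_apply (i j : Fin n) (σ : ℂ) (k : Fin n) :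
    elemU i j σ k = if k = j then X j + C σ * X i else X k := rfl

/-- Exponent bookkeeping: `(m' - d ε_j) + k ε_i + (d-k) ε_j = m' - k ε_j + k ε_i` for `k ≤ d = m'_j`.
[folklore] -/
theorem erase_add_single_add_single {i j : Fin n} (m' : Fin n →₀ ℕ) {k : ℕ} (hk : k ≤ m' j) :
    m'.erase j + Finsupp.single i k + Finsupp.single j (m' j - k) =
      m' - Finsupp.single j k + Finsupp.single i k := by
  classical
  ext l
  simp only [Finsupp.coe_add, Pi.add_apply, Finsupp.erase_apply, Finsupp.single_apply,
    Finsupp.coe_tsub, Pi.sub_apply]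
  by_cases hlj : l = j
  · subst hlj
    by_cases hil : i = l
    · subst hil; simp; omega
    · simp [hil]
  · simp [hlj, Ne.symm hlj]

/-- The two descriptions of the shifted exponent agree (`i ≠ j`):
`k ≤ m'_j ∧ m' - kε_j + kε_i = m` iff `k ≤ m_i ∧ m' = m - kε_i + kε_j`. [folklore] -/
theorem shift_eq_iff {i j : Fin n} (hij : i ≠ j) (m m' : Fin n →₀ ℕ) (k : ℕ) :
    (k ≤ m' j ∧ m' - Finsupp.single j k + Finsupp.single i k = m) ↔
      (k ≤ m i ∧ m' = m - Finsupp.single i k + Finsupp.single j k) := by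
  classical
  have hji : j ≠ i := Ne.symm hij
  constructor
  · rintro ⟨hk, h⟩
    have hl : ∀ l, m' l - (if j = l then k else 0) + (if i = l then k else 0) = m l := fun l => by
      have := DFunLike.congr_fun h l
      simpa only [Finsupp.coe_add, Finsupp.coe_tsub, Pi.add_apply, Pi.sub_apply,
        Finsupp.single_apply] using this
    have hi := hl i
    rw [if_neg hji, if_pos rfl] at hi
    refine ⟨by omega, Finsupp.ext fun l => ?_⟩
    simp only [Finsupp.coe_add, Finsupp.coe_tsub, Pi.add_apply, Pi.sub_apply, Finsupp.single_apply]
    have h1 := hl l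
    by_cases hjl : j = l
    · subst hjl; rw [if_pos rfl, if_neg hij] at h1 ⊢; omega
    · by_cases hil : i = l
      · subst hil; rw [if_neg hjl, if_pos rfl] at h1 ⊢; omega
      · rw [if_neg hjl, if_neg hil] at h1 ⊢; omega
  · rintro ⟨hk, h⟩
    have hl : ∀ l, m' l = m l - (if i = l then k else 0) + (if j = l then k else 0) := fun l => by
      have := DFunLike.congr_fun h l
      simpa only [Finsupp.coe_add, Finsupp.coe_tsub, Pi.add_apply, Pi.sub_apply,
        Finsupp.single_apply] using this
    have hj := hl j
    rw [if_neg hij, if_pos rfl] at hj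
    refine ⟨by omega, Finsupp.ext fun l => ?_⟩
    simp only [Finsupp.coe_add, Finsupp.coe_tsub, Pi.add_apply, Pi.sub_apply, Finsupp.single_apply]
    have h1 := hl l
    by_cases hjl : j = l
    · subst hjl; rw [if_pos rfl, if_neg hij] at h1 ⊢; omega
    · by_cases hil : i = l
      · subst hil; rw [if_neg hjl, if_pos rfl] at h1 ⊢; omega
      · rw [if_neg hjl, if_neg hil] at h1 ⊢; omega

/-- Extending the range of an `if`-sum by recording the bound in the condition. [folklore] -/
theorem sum_range_ite_extend {A B : ℕ} (hAB : A ≤ B) (P : ℕ → Prop) [DecidablePred P] (v : ℕ → ℂ) :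
    ∑ k ∈ Finset.range A, (if P k then v k else 0) =
      ∑ k ∈ Finset.range B, (if k < A ∧ P k then v k else 0) := by
  have h1 : ∑ k ∈ Finset.range A, (if P k then v k else 0) =
      ∑ k ∈ Finset.range A, (if k < A ∧ P k then v k else 0) :=
    Finset.sum_congr rfl fun k hk => by
      have hkA : k < A := Finset.mem_range.mp hk
      by_cases hP : P k
      · rw [if_pos hP, if_pos ⟨hkA, hP⟩]
      · rw [if_neg hP, if_neg fun h => hP h.2]
  rw [h1]
  refine Finset.sum_subset (Finset.range_subset_range.mpr hAB) fun k _ hk => ?_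
  rw [if_neg]
  exact fun h => hk (Finset.mem_range.mpr h.1)

/-- **One monomial under an elementary unipotent**:
`x^{m'} ∘ e_ij(σ) = Σ_{k ≤ m'_j} C(m'_j, k) σ^k x^{m' - kε_j + kε_i}`. [folklore] -/
theorem aeval_elemU_monomial (i j : Fin n) (σ : ℂ) (m' : Fin n →₀ ℕ) :
    aeval (elemU i j σ) (monomial m' (1 : ℂ)) =
      ∑ k ∈ Finset.range (m' j + 1), C (((m' j).choose k : ℂ) * σ ^ k) *
        monomial (m' - Finsupp.single j k + Finsupp.single i k) 1 := by
  classical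
  rw [aeval_monomial, map_one, one_mul]
  -- split off the `j`-th variable
  have hsplit : m' = m'.erase j + Finsupp.single j (m' j) := (Finsupp.erase_add_single j m').symm
  have hprod : (m'.prod fun l k => elemU i j σ l ^ k) =
      (m'.erase j).prod (fun l k => elemU i j σ l ^ k) * (X j + C σ * X i) ^ (m' j) := by
    conv_lhs => rw [hsplit]
    rw [Finsupp.prod_add_index' (fun _ => pow_zero _) (fun _ _ _ => pow_add _ _ _),
      Finsupp.prod_single_index (h := fun l k => elemU i j σ l ^ k) (pow_zero _), elemU_apply, if_pos rfl]
  have herase : ((m'.erase j).prod fun l k => elemU i j σ l ^ k) = monomial (m'.erase j) 1 := by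
    rw [← prod_X_pow_eq_monomial]
    refine Finsupp.prod_congr fun l hl => ?_
    rw [elemU_apply, if_neg]
    intro hlj
    rw [hlj, Finsupp.support_erase, Finset.mem_erase] at hl
    exact hl.1 rfl
  rw [hprod, herase, add_comm (X j), add_pow, Finset.mul_sum]
  refine Finset.sum_congr rfl fun k hk => ?_
  have hk' : k ≤ m' j := Nat.lt_succ_iff.mp (Finset.mem_range.mp hk)
  rw [← erase_add_single_add_single m' hk',
    show monomial (m'.erase j + Finsupp.single i k + Finsupp.single j (m' j - k)) (1 : ℂ) =
      monomial (m'.erase j) 1 * X i ^ k * X j ^ (m' j - k) by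
      rw [X_pow_eq_monomial, X_pow_eq_monomial, monomial_mul, monomial_mul, mul_one, mul_one],
    map_mul, map_pow, map_natCast]
  ring

/-- **Coefficient formula for an elementary unipotent** (`i ≠ j`): for every `g`,
`coeff_m (g ∘ e_ij(σ)) = Σ_{k ≤ m_i} C(m_j + k, k) σ^k coeff_{m - kε_i + kε_j} g`
(`≤ n + 1` terms). [folklore] -/
theorem coeff_aeval_elemU {i j : Fin n} (hij : i ≠ j) (σ : ℂ) (g : MvPolynomial (Fin n) ℂ)
    (m : Fin n →₀ ℕ) :
    coeff m (aeval (elemU i j σ) g) = ∑ k ∈ Finset.range (m i + 1),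
      ((m j + k).choose k : ℂ) * σ ^ k * coeff (m - Finsupp.single i k + Finsupp.single j k) g := by
  classical
  induction g using MvPolynomial.induction_on' with
  | add p q hp hq =>
    rw [map_add, coeff_add, hp, hq, ← Finset.sum_add_distrib]
    exact Finset.sum_congr rfl fun k _ => by rw [coeff_add, mul_add]
  | monomial m' a =>
    rw [show monomial m' a = C a * monomial m' 1 by rw [C_mul_monomial, mul_one], map_mul, aeval_C,
      algebraMap_eq, coeff_C_mul, aeval_elemU_monomial i j, coeff_sum, Finset.mul_sum]
    simp only [coeff_C_mul, coeff_monomial, mul_ite, mul_one, mul_zero]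
    rw [sum_range_ite_extend (show m' j + 1 ≤ m' j + 1 + (m i + 1) by omega),
      sum_range_ite_extend (show m i + 1 ≤ m' j + 1 + (m i + 1) by omega)]
    refine Finset.sum_congr rfl fun k _ => ?_
    by_cases h1 : k < m' j + 1 ∧ m' - Finsupp.single j k + Finsupp.single i k = m
    · have h2 : k ≤ m i ∧ m' = m - Finsupp.single i k + Finsupp.single j k :=
        (shift_eq_iff hij m m' k).mp ⟨by omega, h1.2⟩
      rw [if_pos h1, if_pos ⟨by omega, h2.2⟩]
      have hmj : m' j = m j + k := by
        rw [h2.2]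
        simp [hij]
      rw [hmj]; ring
    · rw [if_neg h1, if_neg]
      rintro ⟨hk, h⟩
      apply h1
      have := (shift_eq_iff hij m m' k).mpr ⟨by omega, h⟩
      exact ⟨by omega, this.2⟩

end elementary

/-! ## §4 The factorisation `u_s = Π_{i<j} e_ij(s_ij)` along the positive roots -/

section factorisation

/-- Row `i` of the positive roots: the pairs `(i, j)`, `i < j`, in increasing `j`. [folklore] -/
def rowList (n : ℕ) (i : Fin n) : List (Fin n × Fin n) :=
  ((List.finRange n).filter (fun j => i < j)).map (fun j => (i, j))

/-- All positive roots `(i, j)`, `i < j`, rows in DECREASING order of `i` (the outermost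
substitution first). [folklore] -/
def pairList (n : ℕ) : List (Fin n × Fin n) :=
  ((List.finRange n).reverse).flatMap (rowList n)

/-- Membership in a row. [folklore] -/
theorem mem_rowList {i : Fin n} {p : Fin n × Fin n} : p ∈ rowList n i ↔ p.1 = i ∧ p.1 < p.2 := by
  simp only [rowList, List.mem_map, List.mem_filter, List.mem_finRange, true_and,
    decide_eq_true_eq]
  constructor
  · rintro ⟨j, hj, rfl⟩; exact ⟨rfl, hj⟩
  · rintro ⟨rfl, h⟩; exact ⟨p.2, h, rfl⟩

/-- `pairList n` lists exactly the positive roots. [folklore] -/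
theorem mem_pairList {p : Fin n × Fin n} : p ∈ pairList n ↔ p.1 < p.2 := by
  simp only [pairList, List.mem_flatMap, List.mem_reverse, List.mem_finRange, true_and, mem_rowList]
  constructor
  · rintro ⟨i, -, h⟩; exact h
  · intro h; exact ⟨p.1, rfl, h⟩

/-- `pairList n` has no duplicates. [folklore] -/
theorem nodup_pairList : (pairList n).Nodup := by
  rw [pairList, List.nodup_flatMap]
  constructor
  · intro i _
    refine List.Nodup.map (fun j j' h => (Prod.mk.inj h).2) (List.Nodup.filter _ (List.nodup_finRange n))
  · refine List.Pairwise.imp_of_mem ?_ (List.nodup_reverse.mpr (List.nodup_finRange n))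
    intro a b _ _ hab
    simp only [Function.onFun, List.disjoint_left]
    intro p hpa hpb
    exact hab ((mem_rowList.mp hpa).1.symm.trans (mem_rowList.mp hpb).1)

/-- `pairList n` is sorted by decreasing row index. [folklore] -/
theorem pairList_sorted : (pairList n).Pairwise (fun p q => q.1 ≤ p.1) := by
  rw [pairList, List.pairwise_flatMap]
  constructor
  · intro i _
    rw [rowList, List.pairwise_map]
    exact List.pairwise_of_forall fun _ _ => le_rfl
  · refine List.Pairwise.imp_of_mem ?_ (List.pairwise_reverse.mpr (List.pairwise_lt_finRange n))
    intro a b _ _ hba p hp q hq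
    rw [(mem_rowList.mp hp).1, (mem_rowList.mp hq).1]
    exact le_of_lt hba

/-- `|pairList n| ≤ n²`. [folklore] -/
theorem length_pairList_le : (pairList n).length ≤ n * n := by
  classical
  rw [← List.toFinset_card_of_nodup nodup_pairList]
  exact (Finset.card_le_univ _).trans (by rw [Fintype.card_prod, Fintype.card_fin])

end factorisation

section composite

/-- The composite of the elementary substitutions along a list of roots (head = outermost):
`U_{p :: ℓ} = e_p(s_p) ∘ U_ℓ`. [folklore] -/
def compU (s : Fin n → Fin n → ℂ) : List (Fin n × Fin n) →
    (MvPolynomial (Fin n) ℂ →ₐ[ℂ] MvPolynomial (Fin n) ℂ)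
  | [] => AlgHom.id ℂ _
  | p :: ℓ => (aeval (elemU p.1 p.2 (s p.1 p.2))).comp (compU s ℓ)

/-- The partial unitriangular substitution along a list of roots:
`x_k ↦ x_k + Σ_{(i,k) ∈ ℓ} s_ik x_i`. [folklore] -/
def unipL (s : Fin n → Fin n → ℂ) (ℓ : List (Fin n × Fin n)) (k : Fin n) : MvPolynomial (Fin n) ℂ :=
  X k + (ℓ.map fun p => if p.2 = k then C (s p.1 p.2) * X p.1 else 0).sum

/-- Unfolding `compU` on a cons. [folklore] -/
theorem compU_cons (s : Fin n → Fin n → ℂ) (p : Fin n × Fin n) (ℓ : List (Fin n × Fin n))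
    (f : MvPolynomial (Fin n) ℂ) :
    compU s (p :: ℓ) f = aeval (elemU p.1 p.2 (s p.1 p.2)) (compU s ℓ f) := rfl

/-- **The composite along a row-sorted list of positive roots is the partial unitriangular
substitution.** [folklore] -/
theorem compU_eq_aeval (s : Fin n → Fin n → ℂ) :
    ∀ (ℓ : List (Fin n × Fin n)), (∀ p ∈ ℓ, p.1 < p.2) → ℓ.Pairwise (fun p q => q.1 ≤ p.1) →
      ∀ f, compU s ℓ f = aeval (unipL s ℓ) f
  | [], _, _, f => by
    have h : unipL s [] = X := by funext k; simp [unipL]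
    rw [h, aeval_X_left]; rfl
  | p :: ℓ, hpos, hsort, f => by
    have hℓpos : ∀ q ∈ ℓ, q.1 < q.2 := fun q hq => hpos q (List.mem_cons_of_mem _ hq)
    have hp : p.1 < p.2 := hpos p List.mem_cons_self
    rw [List.pairwise_cons] at hsort
    -- `e_p(unipL ℓ k) = unipL (p :: ℓ) k`
    have hfix : ∀ q ∈ ℓ, aeval (elemU p.1 p.2 (s p.1 p.2)) (X q.1 : MvPolynomial (Fin n) ℂ) = X q.1 := by
      intro q hq
      rw [aeval_X, elemU_apply, if_neg]
      exact Fin.ne_of_lt (lt_of_le_of_lt (hsort.1 q hq) hp)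
    have hstep : ∀ k, aeval (elemU p.1 p.2 (s p.1 p.2)) (unipL s ℓ k) = unipL s (p :: ℓ) k := by
      intro k
      rw [unipL, unipL, map_add, aeval_X, map_list_sum, List.map_map, List.map_cons, List.sum_cons,
        ← add_assoc]
      congr 1
      · rw [elemU_apply]
        by_cases hk : k = p.2
        · subst hk; rw [if_pos rfl, if_pos rfl]
        · rw [if_neg hk, if_neg (Ne.symm hk), add_zero]
      · congr 1
        refine List.map_congr_left fun q hq => ?_
        simp only [Function.comp_apply]
        by_cases hqk : q.2 = k
        · rw [if_pos hqk, map_mul, aeval_C, algebraMap_eq, hfix q hq]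
        · rw [if_neg hqk, map_zero]
    rw [compU_cons, compU_eq_aeval s ℓ hℓpos hsort.2 f, ← AlgHom.comp_apply, comp_aeval]
    simp only [hstep]

/-- The partial substitution along the full list is `u_s`. [folklore] -/
theorem unipL_pairList (s : Fin n → Fin n → ℂ) : unipL s (pairList n) = unip s := by
  classical
  funext k
  rw [unipL, unip_apply, ← List.sum_toFinset _ nodup_pairList]
  congr 1
  have hset : (pairList n).toFinset = Finset.univ.filter (fun p : Fin n × Fin n => p.1 < p.2) := by
    ext p; rw [List.mem_toFinset, mem_pairList, Finset.mem_filter]; simp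
  rw [hset, Finset.sum_filter, ← Finset.univ_product_univ, Finset.sum_product, Finset.sum_filter]
  refine Finset.sum_congr rfl fun i _ => ?_
  have h : ∀ j : Fin n, (if i < j then (if j = k then C (s i j) * X i else 0) else 0 :
      MvPolynomial (Fin n) ℂ) = if j = k then (if i < k then C (s i k) * X i else 0) else 0 := by
    intro j
    by_cases hjk : j = k
    · subst hjk; by_cases hij : i < j <;> simp [hij]
    · simp [hjk]
  simp_rw [h]
  rw [Finset.sum_ite_eq' Finset.univ k, if_pos (Finset.mem_univ k)]

/-- **`u_s = Π_{(i,j) ∈ pairList} e_ij(s_ij)`** (outermost factor first):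
`aeval (unip s) f = compU s (pairList n) f`. [folklore] -/
theorem aeval_unip_eq_compU (s : Fin n → Fin n → ℂ) (f : MvPolynomial (Fin n) ℂ) :
    aeval (unip s) f = compU s (pairList n) f := by
  rw [compU_eq_aeval s (pairList n) (fun p hp => mem_pairList.mp hp) pairList_sorted f, unipL_pairList]

end composite

end Summit.ValiantsHypothesis.ValiantsHypothesis.Theorems.BarrierLever.IsobaricEquations

end
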